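import Summits.AtomisticToContinuum.Crystallization.Theses.GscTwinLoopSurgery
import Summits.AtomisticToContinuum.Crystallization.Theses.SurfaceTensionNoFoam

/-!
# Birth skeleton for crux `NoFoam` (stmt-AtomisticToContinuum-13453)

Route `GscTwinLoopSurgery` (crux, rank 6) — the item is shared with route `SurfaceTensionNoFoam`
(support, rank 9); both route decls `…Theses.GscTwinLoopSurgery.NoFoam` and
`…Theses.SurfaceTensionNoFoam.NoFoam` have the same body and the skeleton concludes BOTH by name
(`NoFoam_skeleton`, `NoFoam_proof`).

Line `birth` — **wall-cost squeeze at one scale**.  `NoFoam` (cohesion of Lennard-Jones ground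
states: for some void size `r₀`, at every observation scale `R`, the fraction of particles within
`R` of the centre of an empty open `r₀`-ball tends to `0`) is obtained from two named stubs and the
landed energetic crystallization theorem `CrysEnergyLimit_holds` (`E(N)/N → e* = ⨅_Q e(Q)`):

* `stub_scaleReduction` (geometry of δ-separated configurations, size M): at fixed void size `r₀`,
  exposure at scale `R` is controlled by exposure at the single scale `R = r₀` ("wall particles",
  those ON the sphere of an empty open `r₀`-ball): slide the void centre towards its nearest
  particle — that particle is a wall particle within `2R` of the exposed one — and count fibres
  with the hard core `LennardJonesMinimalDistance_holds` and the packing bound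
  `card_le_of_separated_of_dist_le` / `card_ball_le_of_separated`.
* `stub_wallSitesCost` (the physics, open — surface tension of LJ ground states in configuration
  form, the `R = r₀` instance of `SurfaceTensionNoFoam.ExposedSitesCost`, stmt-13448): for some
  `r₀ > 0` and `c > 0`, every wall particle of every `N`-particle ground state costs `c` above the
  periodic infimum, `c · #wall ≤ E(N) − N e*`, uniformly in `N`.

Composition `NoFoam_of : ScaleReduction → WallSitesCost → …Theses.GscTwinLoopSurgery.NoFoam` (the two
stub statements as named propositions `ScaleReduction`, `WallSitesCost`, verbatim the types of the
`stub_*` theorems), kernel-checked without sorry: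
`#exp(r₀,R)/N ≤ C · #wall/N ≤ (C/c) · (E(N)/N − e*) → 0` (squeeze).  Sorries live only in the two
`stub_*` theorems.
-/

namespace Summit.AtomisticToContinuum.Crystallization.Cruxes.NoFoam.Birth

open Filter Topology

/-! ## The two stub statements, as named propositions (verbatim the types of `stub_*` below) -/

/-- The statement of stub A `stub_scaleReduction` (scale reduction for exposure counts of LJ ground
states) as a named proposition — verbatim the type of `stub_scaleReduction` below; the hypotheses of the
composition `NoFoam_of` are these named propositions. [folklore] -/
def ScaleReduction : Prop :=
  ∀ r₀ : ℝ, 0 < r₀ → ∀ R : ℝ, 0 < R → ∃ C : ℝ, 0 ≤ C ∧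
      ∀ (N : ℕ) (x : Fin N → EuclideanSpace ℝ (Fin 3)),
        Literature.MathematicalPhysics.StatisticalMechanics.IsGroundState
            Literature.MathematicalPhysics.StatisticalMechanics.lennardJones x →
          (Nat.card {i : Fin N // ∃ c : EuclideanSpace ℝ (Fin 3), dist c (x i) ≤ R ∧
              ∀ j : Fin N, r₀ ≤ dist c (x j)} : ℝ) ≤
            C * (Nat.card {i : Fin N // ∃ c : EuclideanSpace ℝ (Fin 3), dist c (x i) ≤ r₀ ∧
              ∀ j : Fin N, r₀ ≤ dist c (x j)} : ℝ)

/-- The statement of stub B `stub_wallSitesCost` (wall sites of LJ ground states cost energy above the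
periodic infimum) as a named proposition — verbatim the type of `stub_wallSitesCost` below.
[cite: BlancLewin2015, §2.2] -/
def WallSitesCost : Prop :=
  ∃ r₀ : ℝ, 0 < r₀ ∧ ∃ c : ℝ, 0 < c ∧
      ∀ (N : ℕ) (x : Fin N → EuclideanSpace ℝ (Fin 3)),
        Literature.MathematicalPhysics.StatisticalMechanics.IsGroundState
            Literature.MathematicalPhysics.StatisticalMechanics.lennardJones x →
          c * (Nat.card {i : Fin N // ∃ c : EuclideanSpace ℝ (Fin 3), dist c (x i) ≤ r₀ ∧
              ∀ j : Fin N, r₀ ≤ dist c (x j)} : ℝ) ≤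
            Literature.MathematicalPhysics.StatisticalMechanics.groundStateEnergy
                Literature.MathematicalPhysics.StatisticalMechanics.lennardJones 3 N -
              (N : ℝ) * (⨅ Q : Literature.MathematicalPhysics.StatisticalMechanics.PeriodicConfiguration 3,
                Q.energyPerParticle Literature.MathematicalPhysics.StatisticalMechanics.lennardJones)

/-! ## The stubs (the only sorries of the file) -/

/-- **stub A — scale reduction (geometric, size M).** For every void size `r₀ > 0` and every
observation scale `R > 0` there is `C ≥ 0` such that in every Lennard-Jones ground state the number
of `(r₀,R)`-exposed particles (some empty open `r₀`-ball centred within `R`) is at most `C` times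
the number of wall particles (`R = r₀`: the particle lies on the sphere of an empty open `r₀`-ball).
Proof idea: for an exposed `i` with void centre `c`, let `j` be a particle nearest to `c` and slide
`c` to `c' = x_j + r₀ (c − x_j)/‖c − x_j‖`; then `j` is a wall particle and `dist x_i x_j ≤ 2R`;
the fibres of `i ↦ j` have at most `(4R/δ + 1)³` elements by the uniform minimal distance `δ` of
LJ ground states (`LennardJonesMinimalDistance_holds`) and `card_le_of_separated_of_dist_le`.
For `R < r₀` the exposed set is empty. [folklore] -/
theorem stub_scaleReduction :
    ∀ r₀ : ℝ, 0 < r₀ → ∀ R : ℝ, 0 < R → ∃ C : ℝ, 0 ≤ C ∧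
      ∀ (N : ℕ) (x : Fin N → EuclideanSpace ℝ (Fin 3)),
        Literature.MathematicalPhysics.StatisticalMechanics.IsGroundState
            Literature.MathematicalPhysics.StatisticalMechanics.lennardJones x →
          (Nat.card {i : Fin N // ∃ c : EuclideanSpace ℝ (Fin 3), dist c (x i) ≤ R ∧
              ∀ j : Fin N, r₀ ≤ dist c (x j)} : ℝ) ≤
            C * (Nat.card {i : Fin N // ∃ c : EuclideanSpace ℝ (Fin 3), dist c (x i) ≤ r₀ ∧
              ∀ j : Fin N, r₀ ≤ dist c (x j)} : ℝ) := by
  sorry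

/-- **stub B — wall sites cost energy (the physics; open, size XL).** There are a void size
`r₀ > 0` and a constant `c > 0` such that for every `N` and every `N`-particle Lennard-Jones
ground state `x` in `ℝ³`, `c · #{i : x_i lies on the sphere of an empty open r₀-ball} ≤
E(N) − N · ⨅_Q e(Q)`: vacuum-adjacent particles (outer surface, internal voids and cracks of radius
`≥ r₀`) each cost a definite amount above the periodic infimum `e*`. This is the `R = r₀`
instance of `SurfaceTensionNoFoam.ExposedSitesCost` (stmt-AtomisticToContinuum-13448, which
implies it verbatim) and its local half is `SurfaceTensionNoFoam.VoidWallDeficit` (stmt-13450);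
true physically (positive surface tension `σ_LJ > 0`), open in print (BlancLewin2015 §2.2): a proof
must show that over-bound interior sites cannot pay for the `≈ 15 %` binding deficit of wall
sites. [cite: BlancLewin2015, §2.2] -/
theorem stub_wallSitesCost :
    ∃ r₀ : ℝ, 0 < r₀ ∧ ∃ c : ℝ, 0 < c ∧
      ∀ (N : ℕ) (x : Fin N → EuclideanSpace ℝ (Fin 3)),
        Literature.MathematicalPhysics.StatisticalMechanics.IsGroundState
            Literature.MathematicalPhysics.StatisticalMechanics.lennardJones x →
          c * (Nat.card {i : Fin N // ∃ c : EuclideanSpace ℝ (Fin 3), dist c (x i) ≤ r₀ ∧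
              ∀ j : Fin N, r₀ ≤ dist c (x j)} : ℝ) ≤
            Literature.MathematicalPhysics.StatisticalMechanics.groundStateEnergy
                Literature.MathematicalPhysics.StatisticalMechanics.lennardJones 3 N -
              (N : ℝ) * (⨅ Q : Literature.MathematicalPhysics.StatisticalMechanics.PeriodicConfiguration 3,
                Q.energyPerParticle Literature.MathematicalPhysics.StatisticalMechanics.lennardJones) := by
  sorry

/-! ## The composition (sorry-free) -/

/-- The arithmetic of the squeeze: `a ≤ C b`, `c b ≤ E − n e*` give
`a/n ≤ (C/c)(E/n − e*)` for `n, c > 0`, `C ≥ 0`. [folklore] -/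
theorem squeeze_step {a b C c E n estar : ℝ} (hn : 0 < n) (hc : 0 < c) (hC : 0 ≤ C)
    (h1 : a ≤ C * b) (h2 : c * b ≤ E - n * estar) :
    a / n ≤ (C / c) * (E / n - estar) := by
  have hb : b ≤ (E - n * estar) / c := by
    rw [le_div_iff₀ hc]; linarith
  have h3 : a ≤ C * ((E - n * estar) / c) := h1.trans (by gcongr)
  calc a / n ≤ C * ((E - n * estar) / c) / n := by gcongr
    _ = (C / c) * (E / n - estar) := by
        field_simp

/-- **Composition (kernel-checked, no sorry): stub A → stub B → `NoFoam`** (the crux decl of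
route `GscTwinLoopSurgery`, by name). With `r₀, c` from stub B and `C = C(r₀,R)` from stub A,
along any sequence of ground states `0 ≤ #exp(r₀,R)/N ≤ (C/c)·(E(N)/N − e*)`, and the right-hand
side tends to `0` by the landed theorem `CrysEnergyLimit_holds` (stmt-0626, `E(N)/N → ⨅_Q e(Q)`).
[folklore] -/
theorem NoFoam_of :
    ScaleReduction → WallSitesCost →
      Summit.AtomisticToContinuum.Crystallization.Theses.GscTwinLoopSurgery.NoFoam := by
  intro hA hB
  obtain ⟨r₀, hr₀, c, hc, hcost⟩ := hB
  refine ⟨r₀, hr₀, ?_⟩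
  intro R hR x hx
  obtain ⟨C, hC0, hC⟩ := hA r₀ hr₀ R hR
  -- the landed energetic crystallization theorem: E(N)/N → e* := ⨅_Q e(Q)
  have hlim : Filter.Tendsto
      (fun N : ℕ => Literature.MathematicalPhysics.StatisticalMechanics.groundStateEnergy
        Literature.MathematicalPhysics.StatisticalMechanics.lennardJones 3 N / (N : ℝ))
      Filter.atTop
      (nhds (⨅ Q : Literature.MathematicalPhysics.StatisticalMechanics.PeriodicConfiguration 3,
        Q.energyPerParticle Literature.MathematicalPhysics.StatisticalMechanics.lennardJones)) :=
    Summit.AtomisticToContinuum.Crystallization.Theses.GscTwinLoopSurgery.CrysEnergyLimit_holds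
  -- hence the scaled excess energy per particle tends to 0
  have hexcess : Filter.Tendsto
      (fun N : ℕ => (C / c) *
        (Literature.MathematicalPhysics.StatisticalMechanics.groundStateEnergy
            Literature.MathematicalPhysics.StatisticalMechanics.lennardJones 3 N / (N : ℝ) -
          (⨅ Q : Literature.MathematicalPhysics.StatisticalMechanics.PeriodicConfiguration 3,
            Q.energyPerParticle Literature.MathematicalPhysics.StatisticalMechanics.lennardJones)))
      Filter.atTop (nhds 0) := by
    have h := (hlim.sub_const
      (⨅ Q : Literature.MathematicalPhysics.StatisticalMechanics.PeriodicConfiguration 3,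
        Q.energyPerParticle Literature.MathematicalPhysics.StatisticalMechanics.lennardJones)).const_mul
      (C / c)
    rw [sub_self, mul_zero] at h
    exact h
  refine squeeze_zero' (Filter.Eventually.of_forall fun N => by positivity) ?_ hexcess
  filter_upwards [Filter.eventually_ge_atTop 1] with N hN
  have hNpos : (0 : ℝ) < (N : ℝ) := by exact_mod_cast hN
  exact squeeze_step hNpos hc hC0 (hC N (x N) (hx N)) (hcost N (x N) (hx N))

/-- **Registered target of the skeleton for route `GscTwinLoopSurgery`** — the crux decl BY NAME with
no hypotheses: `NoFoam_of` applied to the two declared stubs (the sorries live in `stub_*` only;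
`#print axioms` reaches `sorryAx` exactly through them; it becomes a proof when both stubs land).
`#h21_check_skeleton … Theses.GscTwinLoopSurgery.NoFoam …` keys on THIS theorem (enumerated before
`NoFoam_of`, verified in the registrar's preflight). [folklore] -/
theorem NoFoam_skeleton :
    Summit.AtomisticToContinuum.Crystallization.Theses.GscTwinLoopSurgery.NoFoam :=
  NoFoam_of stub_scaleReduction stub_wallSitesCost

/-- **Registered target of the skeleton for route `SurfaceTensionNoFoam`** (the item's primary decl —
same body as the `GscTwinLoopSurgery` decl, so the same term proves it), BY NAME, no hypotheses; the
default target of `ledger skeleton check --crux stmt-AtomisticToContinuum-13453`. [folklore] -/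
theorem NoFoam_proof :
    Summit.AtomisticToContinuum.Crystallization.Theses.SurfaceTensionNoFoam.NoFoam :=
  NoFoam_of stub_scaleReduction stub_wallSitesCost

end Summit.AtomisticToContinuum.Crystallization.Cruxes.NoFoam.Birth
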